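import Summits.BirchSwinnertonDyer.BirchSwinnertonDyer.Theses.KolyvaginRoadThree
import Summits.BirchSwinnertonDyer.BirchSwinnertonDyer.Theorems.KolyvaginRoadThreeHalvesTamAtThreeValueContinuity

/-! # Glue of the layer-2 split of `KolyvaginRoadThree.HalvesTamAtThree` (item 19507)

`HalvesTamAtThreeOfChildren : ValueContinuityAtThree → IMCDivTwoLociTamAtThree → HalvesTamAtThree` is
thmc-p1's `kolyvaginRoadThree_halvesTamAtThree_of_valueContinuity_of_imcDivTamStub` (p422252) verbatim. -/

namespace Summit.BirchSwinnertonDyer.BirchSwinnertonDyer.Theorems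

/-- closes glue item stmt-BirchSwinnertonDyer-19507. -/
theorem halvesTamAtThreeOfChildren_holds :
    Summit.BirchSwinnertonDyer.BirchSwinnertonDyer.Theses.KolyvaginRoadThree.HalvesTamAtThreeOfChildren :=
  fun hVC h3 ↦ kolyvaginRoadThree_halvesTamAtThree_of_valueContinuity_of_imcDivTamStub hVC h3

end Summit.BirchSwinnertonDyer.BirchSwinnertonDyer.Theorems
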